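import Summits.NavierStokesRegularity.NavierStokesRegularity.Theorems.OddMorawetzLocal.Negative.OddMorawetzLocalRefutationDefs
import Summits.NavierStokesRegularity.NavierStokesRegularity.Theorems.OddMorawetzOddMorawetzLocalActSignedPerm
import Summits.NavierStokesRegularity.NavierStokesRegularity.Theorems.OddMorawetzOddMorawetzLocalIdxComplete
import HarnessLib

/-!
# The `X¹`-coefficient of the substitution action of `G ≡ 1 (mod X)` is the derivation of `G' (0)`

Crux `OddMorawetzLocal` (item stmt-NavierStokesRegularity-1376), refutation skeleton, stub `der_firstOrder`;
elementary list algebra over the tree's computable jet algebra (`OddMorawetzLocal/Negative/OddMorawetzLocalJetAlgebra`,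
`…RefutationDefs`); Mathlib only, no named facts, no new definitions.

For a `3 × 3` matrix `G` of polynomials with `G.map (coeff 0) = 1` and `L := G.map (coeff 1)`,
`(actMatrix k G).map (coeff 1) = derMatrix k L` (`der_firstOrder`): along a polynomial path of matrices through the
identity, the first-order term of the substitution action `act` on the monomial basis `idx k` is the derivation `der`
of the tangent matrix.  This turns the rotation invariance of an averaged coefficient vector into the integer linear
system `derMatrix k lieZ τ = 0` whose modular rank certificate the kernel checks.

Proof.  `act G [(1, m)]` is the unpruned expansion of the substitution `∂^l v_a ↦ Σ_{b, j} G a b · Π_s G (l_s) (j_s) ·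
∂^{sort j} v_b` multiplied out over the variables of `m`; the coefficient of each expansion term is a product of entries
of `G`.  We pair the term lists with arbitrary test functions `φ` on monomials and track the `X⁰`- and `X¹`-coefficients
of the pairing through `idxImages`, `actVar`, `mul` / `prodList` and the final sorting: modulo `X` every entry is `δ`,
so the `X⁰`-pairing of the image of `∂^l v_a` is `φ [(a, sort l)]` (`actVar_coeff_zero`), and by the Leibniz rule
`(p q).coeff 1 = p.coeff 0 · q.coeff 1 + p.coeff 1 · q.coeff 0` the `X¹`-pairing replaces exactly one slot through `L`
— it is the pairing of the derivation terms `derVar L (a, l)` when `l` is sorted (`actVar_coeff_one`), and Leibniz over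
the factors of a monomial gives the pairing of `der L [(1, m)]` (`prodList_coeff_one`, `act_pair_eq_der_pair`).  The
variables of the basis monomials `idx k` carry sorted index lists (`canonical_of_mem_idx` of the landed
`…IdxComplete`), and `coeffOf` is the pairing with an indicator function.
-/

noncomputable section

-- the problem's tree path `NavierStokesRegularity/NavierStokesRegularity` duplicates a namespace component
set_option linter.dupNamespace false

open scoped Polynomial

namespace Summit.NavierStokesRegularity.NavierStokesRegularity.Theorems.OddMorawetz

namespace DerFirstOrder

variable {R : Type} [CommRing R]

/-- Leibniz rule for the `X¹`-coefficient of a product. -/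
theorem coeff_one_mul (p q : R[X]) : (p * q).coeff 1 = p.coeff 0 * q.coeff 1 + p.coeff 1 * q.coeff 0 := by
  rw [Polynomial.coeff_mul, Finset.Nat.antidiagonal_succ]
  simp

/-- Pairing a `flatMap` with a test function: sum of the pairings of the pieces. -/
theorem sum_map_flatMap {ι β M : Type} [AddMonoid M] (l : List ι) (F : ι → List β) (f : β → M) :
    ((l.flatMap F).map f).sum = (l.map fun i => ((F i).map f).sum).sum := by
  induction l with
  | nil => rfl
  | cons i l ih => rw [List.flatMap_cons, List.map_append, List.sum_append, ih, List.map_cons, List.sum_cons]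

/-- A sum over `Fin 3` against the identity matrix pattern picks one term. -/
theorem sum_finRange_ite_mul (i : Fin 3) (f : Fin 3 → R) :
    ((List.finRange 3).map fun j => (if i = j then (1 : R) else 0) * f j).sum = f i := by
  rw [← Fin.sum_univ_def]
  simp [ite_mul]

/-- The entries of a matrix congruent to `1 mod X` have constant terms `δ`. -/
theorem coeff_zero_entry (G : Matrix (Fin 3) (Fin 3) R[X]) (h0 : G.map (fun q => q.coeff 0) = 1) (a b : Fin 3) :
    (G a b).coeff 0 = if a = b then 1 else 0 := by
  have h := congr_fun (congr_fun h0 a) b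
  rwa [Matrix.map_apply, Matrix.one_apply] at h

/-- `X⁰`: the index images of `l` pair a test function like the single term `(1, l)`. -/
theorem idxImages_coeff_zero (G : Matrix (Fin 3) (Fin 3) R[X]) (h0 : G.map (fun q => q.coeff 0) = 1)
    (l : List (Fin 3)) (φ : List (Fin 3) → R) :
    ((JPoly.idxImages G l).map fun t => t.1.coeff 0 * φ t.2).sum = φ l := by
  induction l generalizing φ with
  | nil => simp [JPoly.idxImages]
  | cons i is ih =>
    have ih' : ∀ j : Fin 3, ((JPoly.idxImages G is).map fun t => t.1.coeff 0 * φ (j :: t.2)).sum = φ (j :: is) :=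
      fun j => ih (fun l => φ (j :: l))
    rw [JPoly.idxImages, sum_map_flatMap]
    simp only [List.map_map, Function.comp_def, Polynomial.mul_coeff_zero, coeff_zero_entry G h0, mul_assoc,
      List.sum_map_mul_left, ih', sum_finRange_ite_mul]

/-- `X¹`: the index images of `l` pair a test function like the one-slot replacements `l[s := j]` weighted by the
`X¹`-coefficients `(G l_s j).coeff 1`. -/
theorem idxImages_coeff_one (G : Matrix (Fin 3) (Fin 3) R[X]) (h0 : G.map (fun q => q.coeff 0) = 1)
    (l : List (Fin 3)) (φ : List (Fin 3) → R) :
    ((JPoly.idxImages G l).map fun t => t.1.coeff 1 * φ t.2).sum =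
      ((List.finRange l.length).map fun s : Fin l.length =>
        ((List.finRange 3).map fun j => (G (l.getD s 0) j).coeff 1 * φ (l.set s j)).sum).sum := by
  induction l generalizing φ with
  | nil => simp [JPoly.idxImages, Polynomial.coeff_one]
  | cons i is ih =>
    have ih0 : ∀ j : Fin 3, ((JPoly.idxImages G is).map fun t => t.1.coeff 0 * φ (j :: t.2)).sum = φ (j :: is) :=
      fun j => idxImages_coeff_zero G h0 is (fun l => φ (j :: l))
    have ih1 : ∀ j : Fin 3, ((JPoly.idxImages G is).map fun t => t.1.coeff 1 * φ (j :: t.2)).sum =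
        ((List.finRange is.length).map fun s : Fin is.length =>
          ((List.finRange 3).map fun j' => (G (is.getD s 0) j').coeff 1 * φ (j :: is.set s j')).sum).sum :=
      fun j => ih (fun l => φ (j :: l))
    rw [JPoly.idxImages, sum_map_flatMap]
    simp only [List.map_map, Function.comp_def, coeff_one_mul, coeff_zero_entry G h0, add_mul, mul_assoc,
      List.sum_map_add, List.sum_map_mul_left, ih0, ih1, sum_finRange_ite_mul]
    rw [List.length_cons, List.finRange_succ (n := is.length), List.map_cons, List.sum_cons, List.map_map]
    simp only [Function.comp_def, Fin.val_zero, Fin.val_succ, List.getD_cons_zero, List.getD_cons_succ,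
      List.set_cons_zero, List.set_cons_succ]
    exact add_comm _ _

/-- `X⁰`: the image of a variable pairs like the single term `(1, [(a, sort l)])`. -/
theorem actVar_coeff_zero (G : Matrix (Fin 3) (Fin 3) R[X]) (h0 : G.map (fun q => q.coeff 0) = 1) (v : JVar)
    (ψ : List JVar → R) :
    ((JPoly.actVar G v).map fun t => t.1.coeff 0 * ψ t.2).sum = ψ [(v.1, sortIdx v.2)] := by
  have h : ∀ b : Fin 3, ((JPoly.idxImages G v.2).map fun t => t.1.coeff 0 * ψ [(b, sortIdx t.2)]).sum =
      ψ [(b, sortIdx v.2)] := fun b => idxImages_coeff_zero G h0 v.2 (fun l => ψ [(b, sortIdx l)])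
  unfold JPoly.actVar
  rw [sum_map_flatMap]
  simp only [List.map_map, Function.comp_def, Polynomial.mul_coeff_zero, coeff_zero_entry G h0, mul_assoc,
    List.sum_map_mul_left, h, sum_finRange_ite_mul]

/-- `X¹`: the image of a variable with a sorted index list pairs like the derivation terms `derVar L v`,
`L = G.map (coeff 1)`. -/
theorem actVar_coeff_one (G : Matrix (Fin 3) (Fin 3) R[X]) (h0 : G.map (fun q => q.coeff 0) = 1) (v : JVar)
    (hv : sortIdx v.2 = v.2) (ψ : List JVar → R) :
    ((JPoly.actVar G v).map fun t => t.1.coeff 1 * ψ t.2).sum =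
      ((JPoly.derVar (G.map fun q => q.coeff 1) v).map fun r => r.1 * ψ [r.2.headD (0, [])]).sum := by
  have h0' : ∀ b : Fin 3, ((JPoly.idxImages G v.2).map fun t => t.1.coeff 0 * ψ [(b, sortIdx t.2)]).sum =
      ψ [(b, sortIdx v.2)] := fun b => idxImages_coeff_zero G h0 v.2 (fun l => ψ [(b, sortIdx l)])
  have h1' : ∀ b : Fin 3, ((JPoly.idxImages G v.2).map fun t => t.1.coeff 1 * ψ [(b, sortIdx t.2)]).sum =
      ((List.finRange v.2.length).map fun s : Fin v.2.length => ((List.finRange 3).map fun j =>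
        (G (v.2.getD s 0) j).coeff 1 * ψ [(b, sortIdx (v.2.set s j))]).sum).sum :=
    fun b => idxImages_coeff_one G h0 v.2 (fun l => ψ [(b, sortIdx l)])
  unfold JPoly.actVar JPoly.derVar
  rw [List.map_append, List.sum_append]
  simp only [List.bind_eq_flatMap, List.pure_def, sum_map_flatMap, List.map_cons, List.map_nil, List.sum_cons,
    List.sum_nil, add_zero, List.map_map, Function.comp_def, coeff_one_mul, coeff_zero_entry G h0, add_mul,
    mul_assoc, List.sum_map_add, List.sum_map_mul_left, h0', h1', sum_finRange_ite_mul, List.headD_cons,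
    Matrix.map_apply, hv]
  exact add_comm _ _

/-- `X⁰` of a product: Leibniz with no derivative. -/
theorem mul_coeff_zero_pair (p q : JPoly R[X]) (φ : List JVar → R) :
    ((JPoly.mul p q).map fun u => u.1.coeff 0 * φ u.2).sum =
      (p.map fun s => s.1.coeff 0 * (q.map fun t => t.1.coeff 0 * φ (s.2 ++ t.2)).sum).sum := by
  unfold JPoly.mul
  rw [sum_map_flatMap]
  simp only [List.map_map, Function.comp_def, Polynomial.mul_coeff_zero, mul_assoc, List.sum_map_mul_left]

/-- `X¹` of a product: the Leibniz rule. -/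
theorem mul_coeff_one_pair (p q : JPoly R[X]) (φ : List JVar → R) :
    ((JPoly.mul p q).map fun u => u.1.coeff 1 * φ u.2).sum =
      (p.map fun s => s.1.coeff 0 * (q.map fun t => t.1.coeff 1 * φ (s.2 ++ t.2)).sum).sum +
        (p.map fun s => s.1.coeff 1 * (q.map fun t => t.1.coeff 0 * φ (s.2 ++ t.2)).sum).sum := by
  unfold JPoly.mul
  rw [sum_map_flatMap, ← List.sum_map_add]
  congr 1
  apply List.map_congr_left
  intro s _
  simp only [List.map_map, Function.comp_def, coeff_one_mul, add_mul, mul_assoc, List.sum_map_add,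
    List.sum_map_mul_left]

/-- `X⁰` of a product of variable images, each constant-term-concentrated at the variable itself. -/
theorem prodList_coeff_zero (F : JVar → JPoly R[X]) (m : List JVar)
    (hF0 : ∀ v ∈ m, ∀ ψ : List JVar → R, ((F v).map fun t => t.1.coeff 0 * ψ t.2).sum = ψ [v])
    (φ : List JVar → R) :
    ((JPoly.prodList (m.map F)).map fun t => t.1.coeff 0 * φ t.2).sum = φ m := by
  induction m generalizing φ with
  | nil => simp [JPoly.prodList]
  | cons v m ih =>
    have ih' : ∀ s : R[X] × List JVar,
        ((JPoly.prodList (m.map F)).map fun t => t.1.coeff 0 * φ (s.2 ++ t.2)).sum = φ (s.2 ++ m) :=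
      fun s => ih (fun w hw => hF0 w (List.mem_cons_of_mem v hw)) (fun x => φ (s.2 ++ x))
    rw [List.map_cons, JPoly.prodList, mul_coeff_zero_pair]
    simp only [ih']
    exact hF0 v List.mem_cons_self (fun x => φ (x ++ m))

/-- `X¹` of a product of variable images: one factor differentiated (Leibniz over the slots of `m`). -/
theorem prodList_coeff_one (F : JVar → JPoly R[X]) (Dv : JVar → List (R × List JVar)) (m : List JVar)
    (hF0 : ∀ v ∈ m, ∀ ψ : List JVar → R, ((F v).map fun t => t.1.coeff 0 * ψ t.2).sum = ψ [v])
    (hF1 : ∀ v ∈ m, ∀ ψ : List JVar → R, ((F v).map fun t => t.1.coeff 1 * ψ t.2).sum =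
      ((Dv v).map fun r => r.1 * ψ [r.2.headD (0, [])]).sum)
    (φ : List JVar → R) :
    ((JPoly.prodList (m.map F)).map fun t => t.1.coeff 1 * φ t.2).sum =
      ((List.finRange m.length).map fun s : Fin m.length =>
        ((Dv (m.getD s (0, []))).map fun r => r.1 * φ (m.set s (r.2.headD (0, [])))).sum).sum := by
  induction m generalizing φ with
  | nil => simp [JPoly.prodList, Polynomial.coeff_one]
  | cons v m ih =>
    have ih0 : ∀ s : R[X] × List JVar,
        ((JPoly.prodList (m.map F)).map fun t => t.1.coeff 0 * φ (s.2 ++ t.2)).sum = φ (s.2 ++ m) :=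
      fun s => prodList_coeff_zero F m (fun w hw => hF0 w (List.mem_cons_of_mem v hw)) (fun x => φ (s.2 ++ x))
    have ih1 : ∀ s : R[X] × List JVar,
        ((JPoly.prodList (m.map F)).map fun t => t.1.coeff 1 * φ (s.2 ++ t.2)).sum =
          ((List.finRange m.length).map fun s' : Fin m.length => ((Dv (m.getD s' (0, []))).map fun r =>
            r.1 * φ (s.2 ++ m.set s' (r.2.headD (0, [])))).sum).sum :=
      fun s => ih (fun w hw => hF0 w (List.mem_cons_of_mem v hw)) (fun w hw => hF1 w (List.mem_cons_of_mem v hw))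
        (fun x => φ (s.2 ++ x))
    rw [List.map_cons, JPoly.prodList, mul_coeff_one_pair]
    simp only [ih0, ih1]
    rw [hF0 v List.mem_cons_self (fun x => ((List.finRange m.length).map fun s' : Fin m.length =>
      ((Dv (m.getD s' (0, []))).map fun r => r.1 * φ (x ++ m.set s' (r.2.headD (0, [])))).sum).sum),
      hF1 v List.mem_cons_self (fun x => φ (x ++ m))]
    rw [List.length_cons, List.finRange_succ (n := m.length), List.map_cons, List.sum_cons, List.map_map]
    simp only [Function.comp_def, Fin.val_zero, Fin.val_succ, List.getD_cons_zero, List.getD_cons_succ,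
      List.set_cons_zero, List.set_cons_succ, List.singleton_append]
    exact add_comm _ _

/-- The `X¹`-pairing of the action of `G` on a one-term polynomial with sorted index lists is the pairing of the
derivation of `L = G.map (coeff 1)`. -/
theorem act_pair_eq_der_pair (G : Matrix (Fin 3) (Fin 3) R[X]) (h0 : G.map (fun q => q.coeff 0) = 1)
    (m : List JVar) (hm : ∀ v ∈ m, sortIdx v.2 = v.2) (φ : List JVar → R) :
    ((JPoly.act G [(1, m)]).map fun t => t.1.coeff 1 * φ t.2).sum =
      ((JPoly.der (G.map fun q => q.coeff 1) [(1, m)]).map fun t => t.1 * φ t.2).sum := by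
  have hF0 : ∀ v ∈ m, ∀ ψ : List JVar → R,
      ((JPoly.actVar G v).map fun t => t.1.coeff 0 * ψ t.2).sum = ψ [v] := by
    intro v hv ψ
    rw [actVar_coeff_zero G h0 v ψ, hm v hv]
  have hF1 : ∀ v ∈ m, ∀ ψ : List JVar → R, ((JPoly.actVar G v).map fun t => t.1.coeff 1 * ψ t.2).sum =
      ((JPoly.derVar (G.map fun q => q.coeff 1) v).map fun r => r.1 * ψ [r.2.headD (0, [])]).sum :=
    fun v hv ψ => actVar_coeff_one G h0 v (hm v hv) ψ
  have h := prodList_coeff_one (JPoly.actVar G) (JPoly.derVar (G.map fun q => q.coeff 1)) m hF0 hF1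
    (fun x => φ (sortVars x))
  unfold JPoly.act JPoly.subst JPoly.der
  rw [List.flatMap_singleton, List.flatMap_singleton]
  simp only [List.map_map, Function.comp_def, one_mul, sum_map_flatMap]
  exact h

/-- Coefficients of a coefficient sum at a key. -/
theorem coeff_keySum (p : JPoly R[X]) (μ : List JVar) (n : ℕ) :
    Polynomial.coeff (p.map fun t : R[X] × List JVar => if t.2 = μ then t.1 else 0).sum n =
      (p.map fun t : R[X] × List JVar => if t.2 = μ then t.1.coeff n else 0).sum := by
  induction p with
  | nil => simp
  | cons t p ih =>
    rw [List.map_cons, List.sum_cons, Polynomial.coeff_add, ih, List.map_cons, List.sum_cons]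
    split_ifs
    · rfl
    · rw [Polynomial.coeff_zero]

end DerFirstOrder

open ActSignedPerm DerFirstOrder in
/-- **Stub `der_firstOrder` (refutation of `OddMorawetzLocal`).** For a polynomial matrix `G ≡ 1 (mod X)` the
`X¹`-coefficient of the matrix of the substitution action `act G` on the monomial basis `idx k` is the matrix of
the derivation induced by `L = G.map (coeff 1)`: in the unpruned expansion of `act G` on a basis monomial every
term's coefficient is a product of entries of `G`, whose `X¹`-coefficient (Leibniz) is non-zero only when all but
one factor sit on the diagonal, and these terms are exactly the terms of `der L`. -/
theorem der_firstOrder {R : Type} [CommRing R] (k : ℕ) (G : Matrix (Fin 3) (Fin 3) (Polynomial R))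
    (h0 : G.map (fun q => q.coeff 0) = 1) :
    (actMatrix k G).map (fun q => q.coeff 1) = derMatrix k (G.map fun q => q.coeff 1) := by
  ext i j
  rw [Matrix.map_apply]
  unfold actMatrix derMatrix
  rw [Matrix.of_apply, Matrix.of_apply, coeffOf_eq_keySum, coeffOf_eq_keySum, coeff_keySum]
  have h := act_pair_eq_der_pair G h0 ((idx k).get j)
    (fun v hv => ((canonical_of_mem_idx (List.get_mem _ j)).2.2.1 v hv).1)
    (fun x => if x = (idx k).get i then 1 else 0)
  simp only [mul_ite, mul_one, mul_zero] at h
  exact h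

end Summit.NavierStokesRegularity.NavierStokesRegularity.Theorems.OddMorawetz

end
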